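import Mathlib
import Summits.Ventures.HodgeRepro.Tier4.Target

/-!
# Tier4/Line3/CongruenceIndex — coset representatives of `Γ ∩ Γ(M)` in `Γ`, at most `M^{9d}` of them
(rung for L3.4 / L3.5: the index bound of `Loc.level_le`)

Blind re-derivation cell `pub-hodge-repro`, Tier 4 «PROVE THE STEP» (README §9–§10), LINE L3, seat t4-L2-p3 on L3.5
`term_dominated` (lead S12234).

`Loc.level_le` (Skeleton v0.12+, S12270) bounds the depth-`N` level from below by `Γ ∩ Γ(q₀^N)`; the orbital term is an
integral over a fundamental domain of the level, and the tiling of that domain by translates of a fundamental domain of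
`Γ` (t4-L3-p1's DomainTransfer) costs the INDEX `[Γ : Γ ∩ Γ(M)]`.  This file bounds it without any group-theoretic
machinery on sets of matrices: for a congruence subgroup `Γ` (`IsCongruenceSubgroup c H Γ`: a group of INTEGRAL unitary
matrices) and `M ≥ 1`,

  `∃ R ⊆ Γ, R finite, Nat.card R ≤ (M^d)^9 and ∀ γ ∈ Γ, ∃ r ∈ R, ∃ δ ∈ Γ ∩ Γ(M), γ = r · δ`

(`exists_cosetReps_principalCongruence`), `d = [E : ℚ]`: reduce the (integral) entries modulo `M 𝒪_E` — the reduction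
takes at most `|𝒪_E / M 𝒪_E|^9 = (M^d)^9` values (`Ideal.absNorm` of the principal ideal `(M)` is `|N(M)| = M^d`) —, pick one
element of `Γ` in each fibre, and note that two elements of `Γ` with the same reduction differ by an element of
`Γ ∩ Γ(M)` (`r⁻¹ γ − 1 = r⁻¹ (γ − r)` has entries in `M 𝒪_E`, `r⁻¹` being integral).

Nothing here asserts anything about the truth of (P); HC_CM is NOT proved by anyone in this repository.
-/

set_option autoImplicit false

noncomputable section

namespace Summit.Ventures.HodgeRepro.Tier4.Line3

open Matrix NumberField

section CongruenceIndex

variable {E : Type*} [Field E] (c : E ≃+* E) (H : Matrix (Fin 3) (Fin 3) E)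

/-- Elements of a congruence subgroup are integral matrices. -/
theorem isIntegralMatrix_of_mem {Γ : Set (Matrix (Fin 3) (Fin 3) E)} (hΓ : IsCongruenceSubgroup c H Γ)
    {γ : Matrix (Fin 3) (Fin 3) E} (hγ : γ ∈ Γ) : IsIntegralMatrix γ :=
  (hΓ.2.2.2.1 hγ).2.1

/-- Elements of a congruence subgroup are unitary. -/
theorem isUnitaryOf_of_mem {Γ : Set (Matrix (Fin 3) (Fin 3) E)} (hΓ : IsCongruenceSubgroup c H Γ)
    {γ : Matrix (Fin 3) (Fin 3) E} (hγ : γ ∈ Γ) : IsUnitaryOf c H γ :=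
  (hΓ.2.2.2.1 hγ).1

/-- A congruence subgroup contains a two-sided inverse of each of its elements. -/
theorem exists_two_sided_inv_mem {Γ : Set (Matrix (Fin 3) (Fin 3) E)} (hΓ : IsCongruenceSubgroup c H Γ)
    {γ : Matrix (Fin 3) (Fin 3) E} (hγ : γ ∈ Γ) : ∃ h ∈ Γ, γ * h = 1 ∧ h * γ = 1 := by
  obtain ⟨h, hh, hγh⟩ := hΓ.2.2.1 γ hγ
  exact ⟨h, hh, hγh, mul_eq_one_comm.mp hγh⟩

variable [NumberField E]

/-- The entry of a matrix as an algebraic integer (junk `0` when the entry is not integral). -/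
def entryInt (g : Matrix (Fin 3) (Fin 3) E) (i j : Fin 3) : RingOfIntegers E :=
  haveI := Classical.dec (IsIntegral ℤ (g i j))
  if h : IsIntegral ℤ (g i j) then ⟨g i j, h⟩ else 0

omit [NumberField E] in
/-- For an integral matrix, `entryInt` is the entry. -/
theorem coe_entryInt {g : Matrix (Fin 3) (Fin 3) E} (hg : IsIntegralMatrix g) (i j : Fin 3) :
    algebraMap (RingOfIntegers E) E (entryInt g i j) = g i j := by
  simp only [entryInt, dif_pos (hg i j)]
  rfl

/-- The reduction of the entries modulo `M`. -/
def reduceMod (M : ℕ) (g : Matrix (Fin 3) (Fin 3) E) :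
    Fin 3 → Fin 3 → RingOfIntegers E ⧸ Ideal.span {(M : RingOfIntegers E)} :=
  fun i j => Ideal.Quotient.mk _ (entryInt g i j)

omit [NumberField E] in
/-- Two integral matrices with the same reduction differ entrywise by a multiple of `M`. -/
theorem exists_entry_sub_eq_of_reduceMod_eq (M : ℕ) {g g' : Matrix (Fin 3) (Fin 3) E} (hg : IsIntegralMatrix g)
    (hg' : IsIntegralMatrix g') (h : reduceMod M g = reduceMod M g') (i j : Fin 3) :
    ∃ m : RingOfIntegers E, g i j - g' i j = (M : E) * algebraMap (RingOfIntegers E) E m := by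
  have h1 : Ideal.Quotient.mk (Ideal.span {(M : RingOfIntegers E)}) (entryInt g i j) =
      Ideal.Quotient.mk _ (entryInt g' i j) := congrFun (congrFun h i) j
  rw [Ideal.Quotient.eq, Ideal.mem_span_singleton] at h1
  obtain ⟨m, hm⟩ := h1
  refine ⟨m, ?_⟩
  have := congrArg (algebraMap (RingOfIntegers E) E) hm
  simp only [map_sub, map_mul, map_natCast] at this
  rw [coe_entryInt hg, coe_entryInt hg'] at this
  exact this

/-- The number of reductions: `Nat.card (𝒪 ⧸ (M)) = M^d`. -/
theorem card_quot_span_natCast (M : ℕ) :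
    Nat.card (RingOfIntegers E ⧸ Ideal.span {(M : RingOfIntegers E)}) = M ^ Module.finrank ℚ E := by
  rw [← Submodule.cardQuot_apply, ← Ideal.absNorm_apply, Ideal.absNorm_span_singleton]
  have h : (M : RingOfIntegers E) = algebraMap ℤ (RingOfIntegers E) (M : ℤ) := by simp
  rw [h, Algebra.norm_algebraMap, RingOfIntegers.rank]
  simp

/-- The reductions form a finite type. -/
theorem finite_quot_span_natCast (M : ℕ) (hM : 1 ≤ M) :
    Finite (RingOfIntegers E ⧸ Ideal.span {(M : RingOfIntegers E)}) := by
  apply Ideal.finiteQuotientOfFreeOfNeBot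
  rw [Ne, Ideal.span_singleton_eq_bot]
  exact_mod_cast (by omega : M ≠ 0)

/-- **COSET REPRESENTATIVES OF `Γ ∩ Γ(M)` IN `Γ`, AT MOST `(M^d)^9` OF THEM.** -/
theorem exists_cosetReps_principalCongruence {Γ : Set (Matrix (Fin 3) (Fin 3) E)}
    (hΓ : IsCongruenceSubgroup c H Γ) (M : ℕ) (hM : 1 ≤ M) :
    ∃ R : Set (Matrix (Fin 3) (Fin 3) E), R.Finite ∧ R ⊆ Γ ∧
      Nat.card R ≤ (M ^ Module.finrank ℚ E) ^ 9 ∧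
      ∀ γ ∈ Γ, ∃ r ∈ R, ∃ δ ∈ Γ ∩ principalCongruence c H M, γ = r * δ := by
  classical
  haveI := finite_quot_span_natCast (E := E) M hM
  -- the representatives: one element of `Γ` in each fibre of the reduction
  let rep : (Fin 3 → Fin 3 → RingOfIntegers E ⧸ Ideal.span {(M : RingOfIntegers E)}) →
      Matrix (Fin 3) (Fin 3) E :=
    fun q => if h : ∃ γ ∈ Γ, reduceMod M γ = q then Classical.choose h else 1
  have hrep : ∀ q, (∃ γ ∈ Γ, reduceMod M γ = q) → rep q ∈ Γ ∧ reduceMod M (rep q) = q := by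
    intro q hq
    simp only [rep, dif_pos hq]
    exact Classical.choose_spec hq
  refine ⟨rep '' (reduceMod M '' Γ), (Set.toFinite _).image _, ?_, ?_, ?_⟩
  · rintro _ ⟨q, ⟨γ, hγ, rfl⟩, rfl⟩
    exact (hrep _ ⟨γ, hγ, rfl⟩).1
  · -- the count: at most the number of reductions
    calc Nat.card (rep '' (reduceMod M '' Γ)) ≤ Nat.card (reduceMod M '' Γ) := Nat.card_image_le (Set.toFinite _)
      _ ≤ Nat.card (Set.univ : Set (Fin 3 → Fin 3 → RingOfIntegers E ⧸ Ideal.span {(M : RingOfIntegers E)})) :=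
          Nat.card_mono Set.finite_univ (Set.subset_univ _)
      _ = (M ^ Module.finrank ℚ E) ^ 9 := by
          rw [Nat.card_univ, Nat.card_fun, Nat.card_fun, card_quot_span_natCast M, Nat.card_fin, ← pow_mul]
  · intro γ hγ
    obtain ⟨hr, hred⟩ := hrep (reduceMod M γ) ⟨γ, hγ, rfl⟩
    set r := rep (reduceMod M γ) with hrdef
    obtain ⟨h, hh, hrh, hhr⟩ := exists_two_sided_inv_mem c H hΓ hr
    refine ⟨r, ⟨_, ⟨γ, hγ, rfl⟩, rfl⟩, h * γ, ⟨hΓ.2.1 h hh γ hγ, ?_⟩, ?_⟩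
    · -- `h γ ∈ Γ(M)`
      have hmem : h * γ ∈ Γ := hΓ.2.1 h hh γ hγ
      refine ⟨isUnitaryOf_of_mem c H hΓ hmem, isIntegralMatrix_of_mem c H hΓ hmem, fun i j => ?_⟩
      -- `h γ − 1 = h (γ − r)`, entries in `M 𝒪`
      have hγint := isIntegralMatrix_of_mem c H hΓ hγ
      have hrint := isIntegralMatrix_of_mem c H hΓ hr
      have hhint := isIntegralMatrix_of_mem c H hΓ hh
      have hdiff : ∀ k, ∃ m : RingOfIntegers E, γ k j - r k j = (M : E) * algebraMap (RingOfIntegers E) E m :=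
        fun k => exists_entry_sub_eq_of_reduceMod_eq M hγint hrint hred.symm k j
      choose m hm using hdiff
      refine ⟨∑ k, h i k * algebraMap (RingOfIntegers E) E (m k),
        IsIntegral.sum _ fun k _ => (hhint i k).mul (RingOfIntegers.isIntegral_coe _), ?_⟩
      have e : (h * γ - 1) i j = (h * (γ - r)) i j := by
        rw [Matrix.mul_sub, hhr]
      rw [← Matrix.sub_apply, e]
      simp only [Matrix.mul_apply, Matrix.sub_apply]
      rw [Finset.mul_sum]
      refine Finset.sum_congr rfl fun k _ => ?_
      rw [hm k]
      ring
    · rw [← Matrix.mul_assoc, hrh, Matrix.one_mul]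

end CongruenceIndex

end Summit.Ventures.HodgeRepro.Tier4.Line3

end
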